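import Summits.AtomisticToContinuum.Crystallization.Theorems.ChartedZeroExcessLayeredLatticeLiouville

/-!
# ChartedZeroExcessLayered · LatticeLiouville — part B/8: §A «THE KERNEL» + v8 bounded fibre, §B the LJ (multi)lattice (decomp-a2c lens-2 g24 `LatticeLiouville.lean` v8 sha256 4defadc6…, lines 365–686,
split at the `##` / `###` doc-heading boundaries for the gate's 400-line limit (cut table of critic row 444, §C cut once more at §C‴); content byte-identical; ONE
namespace `…Theorems.ChartedZeroExcessLayeredLatticeLiouville` across the parts, linear import chain. Part A's `section Abstract` is re-opened here with the same `variable` line.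
-/

noncomputable section

open scoped BigOperators InnerProductSpace RealInnerProductSpace
open MeasureTheory Set Metric
open Summit.AtomisticToContinuum.Crystallization.Theorems.ChartedPlanarOrderRigidityDoor (E3 IsClean IsNash IsCharted VisibleGap PertRegime atomsIn)
open Summit.AtomisticToContinuum.Crystallization.Theorems.ChartedPlanarOrderDensityDichotomy (μS IsSep)
open Summit.AtomisticToContinuum.Crystallization.Theorems.ChartedPlanarOrderMesoCut (IsDoorSet NearHom LayeredHom EnvClose)
open Summit.AtomisticToContinuum.Crystallization.Theorems.OverbindingBudgetLiouvilleDictionary (NearHomBD nearHom_of_nearHomBD)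
open Summit.AtomisticToContinuum.Crystallization.Theorems.ChartedPlanarOrderDoorLayered
  (TwoPeriodic not_twoPeriodic_singleton DoorHomogeneityBD DoorPeriodic PeriodicBulkGapDoor PeriodicBulkGap
   doorPeriodic_of_doorHomogeneityBD gap_and_pert_1_50_of_periodic gap_and_pert_1_50_of_periodic'
   NearHomL2BD CleanScaleCoherenceL2BD FlatnessExactL2BD doorPeriodic_of_L2 cleanScaleCoherenceL2BD_of_large nearHomL2BD_mono Layered)
open Summit.AtomisticToContinuum.Crystallization.Theorems.ChartedPlanarOrderDoorLayeredOsc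
  (IsTwoShellAffineGood OscillationImprovement DoorPeriodicOsc doorPeriodic_of_osc doorPeriodicOsc_of_doorPeriodic
   oscillationImprovement_of_ge)
open Literature.MathematicalPhysics.StatisticalMechanics (triangularVec₁ triangularVec₂)

namespace Summit.AtomisticToContinuum.Crystallization.Theorems.ChartedZeroExcessLayeredLatticeLiouville

section Abstract

variable {d : ℕ} {ι : Type*} {V : Type*} [NormedAddCommGroup V] [InnerProductSpace ℝ V]

/-! ### THE KERNEL (proved) -/

/-- **K1 · generic piece ⇒ modal Liouville.**  The increment fields `u(· + e_j) − u` of a bounded-gradient harmonic field are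
bounded harmonic, hence (BoundedFlat) cell-independent Γ-modes `a j`; constant increments along every axis make `u` affine with
gradients `a j` and constants `u 0`. -/
theorem linLiouvilleModal_of_boundedFlat {K : Cell d → ι → ι → (V →L[ℝ] V)} (hG : BoundedFlat K) :
    LinLiouvilleModal K := by
  intro u hu hg
  classical
  -- the Γ-modes of the increments
  have hex : ∀ j : Fin d, ∃ v : ι → V, ∀ γ α, incr u (Pi.single j 1) γ α = v α :=
    fun j => hG _ (hu.incr _) (isBdd_incr_of_boundedGradient hg _)
  choose a ha using hex
  refine ⟨a, fun α => u 0 α, fun j => ?_, fun γ α => ?_⟩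
  · exact isHarmonic_congr (ha j) (hu.incr (Pi.single j 1))
  · -- f γ := u γ α - Σ_j γ_j • a j α is shift invariant
    have key := eq_of_forall_shift (f := fun γ : Cell d => u γ α - ∑ j, (γ j : ℝ) • a j α) ?_ γ
    · have key' : u γ α - ∑ j, (γ j : ℝ) • a j α = u 0 α := by simpa using key
      beta_reduce
      rw [← key']
      abel
    · intro γ' j
      have hincr : u (γ' + Pi.single j 1) α = u γ' α + a j α := by
        have := ha j γ' α
        simp only [incr] at this
        rw [← this]; abel
      simp only [hincr, Pi.add_apply, Int.cast_add, add_smul, Finset.sum_add_distrib, sum_single_smul, Int.cast_one,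
        one_smul]
      abel

/-- **K1′ · converse: the modal Liouville theorem gives back the generic piece** (so `BoundedFlat K ⟺ LinLiouvilleModal K`). -/
theorem boundedFlat_of_linLiouvilleModal {K : Cell d → ι → ι → (V →L[ℝ] V)} (hM : LinLiouvilleModal K) :
    BoundedFlat K := by
  intro u hu hb
  classical
  obtain ⟨C, hC⟩ := hb
  have hg : BoundedGradient u := by
    refine ⟨2 * |C|, fun γ γ' α β => ?_⟩
    have h1 := hC γ' β
    have h2 := hC γ α
    have hd : 0 ≤ dist γ γ' := dist_nonneg
    calc ‖u γ' β - u γ α‖ ≤ ‖u γ' β‖ + ‖u γ α‖ := norm_sub_le _ _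
      _ ≤ |C| + |C| := add_le_add (h1.trans (le_abs_self C)) (h2.trans (le_abs_self C))
      _ = 2 * |C| * 1 := by ring
      _ ≤ 2 * |C| * (dist γ γ' + 1) := by
          apply mul_le_mul_of_nonneg_left (by linarith) (by positivity)
  obtain ⟨a, c, _, hrep⟩ := hM u hu hg
  -- boundedness along the ray n • e_j kills every gradient a j α
  have ha0 : ∀ j α, a j α = 0 := by
    intro j α
    refine eq_zero_of_forall_norm_natCast_smul_add_le (x := a j α) (y := c α) (C := C) fun n => ?_
    have h := hC (Pi.single j (n : ℤ)) α
    rw [hrep, sum_single_smul] at h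
    simpa using h
  refine ⟨c, fun γ α => ?_⟩
  rw [hrep γ α]
  simp [ha0]

/-- **K2 · modal target ∧ special piece ⇒ TARGET.** -/
theorem linLiouville_of_modal {K : Cell d → ι → ι → (V →L[ℝ] V)} (hM : LinLiouvilleModal K) (hΓ : GammaKernel K) :
    LinLiouville K := by
  intro u hu hg
  obtain ⟨a, c, hmode, hrep⟩ := hM u hu hg
  rcases isEmpty_or_nonempty ι with hι | ⟨⟨α₀⟩⟩
  · exact ⟨fun _ => 0, c, fun γ α => (IsEmpty.false α).elim⟩
  · refine ⟨fun j => a j α₀, c, fun γ α => ?_⟩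
    rw [hrep γ α]
    congr 1
    exact Finset.sum_congr rfl fun j _ => by rw [hΓ (a j) (hmode j) α α₀]

/-- **K = K2 ∘ K1 · generic ∧ special ⇒ TARGET.** -/
theorem linLiouville_of_boundedFlat_of_gammaKernel {K : Cell d → ι → ι → (V →L[ℝ] V)}
    (hG : BoundedFlat K) (hΓ : GammaKernel K) : LinLiouville K :=
  linLiouville_of_modal (linLiouvilleModal_of_boundedFlat hG) hΓ

/-- **WEAKER certificate for the generic piece: TARGET ⇒ G.** -/
theorem boundedFlat_of_linLiouville {K : Cell d → ι → ι → (V →L[ℝ] V)} (hT : LinLiouville K) : BoundedFlat K := by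
  refine boundedFlat_of_linLiouvilleModal fun u hu hg => ?_
  obtain ⟨a, c, hrep⟩ := hT u hu hg
  -- a common gradient is, in particular, modal: the cell-independent field (fun _ => a j) has all increments zero
  refine ⟨fun j _ => a j, c, fun j => ?_, hrep⟩
  intro γ α
  simp

/-- **Bravais rung of the special piece (PROVED): a monatomic lattice (fcc) has no optical Γ-modes.** -/
theorem gammaKernel_of_subsingleton [Subsingleton ι] (K : Cell d → ι → ι → (V →L[ℝ] V)) : GammaKernel K :=
  fun v _ α β => congrArg v (Subsingleton.elim α β)

/-- for Bravais lattices the TARGET is the generic piece. -/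
theorem linLiouville_of_boundedFlat_bravais [Subsingleton ι] {K : Cell d → ι → ι → (V →L[ℝ] V)}
    (hG : BoundedFlat K) : LinLiouville K :=
  linLiouville_of_boundedFlat_of_gammaKernel hG (gammaKernel_of_subsingleton K)

/-- the analytic reduction composed with the kernel: certificate ⇒ TARGET (modulo `DecayFromCoercivity`). -/
theorem linLiouville_of_decay {K : Cell d → ι → ι → (V →L[ℝ] V)} (hD : DecayFromCoercivity K)
    (hS : Symm K) (hA : SelfAdj K) (hM : Moment₂ K) (hC : ∃ κ : ℝ, 0 < κ ∧ Coercive K κ) : LinLiouville K :=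
  linLiouville_of_boundedFlat_of_gammaKernel (hD hS hA hM hC).1 (hD hS hA hM hC).2

/-! ### v8 (generation 24): the BOUNDED special fibre and the LAYER-LOCAL energy currency for index set `ℤ` (layered structures)

For a FINITE index set `ι` (periodic multilattices) a Γ-mode is automatically bounded and `GammaKernel` is the right special piece.  For
`ι = ℤ` — the layers of an APERIODIC stacking `Layered a b w`, §D — it is not: the layer chain admits the genuine unbounded Γ-modes
`m ↦ m • e + r m` (uniform normal strain plus per-layer registry), which ARE bounded-GRADIENT harmonic fields and are affine, not translations.
The kernel K2 only ever feeds BOUNDED Γ-modes to the special piece (the increments of a bounded-gradient field are bounded), so the right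
special piece is `GammaKernelBdd` and the exhaustion `linLiouville_of_boundedFlat_of_gammaKernelBdd` is PROVED verbatim.  On the energy side the
all-pairs index form `nnForm` couples arbitrarily distant layers (no `κ > 0` survives as the support height grows) and `Moment₂` weighs only the
cell distance; the layer-local currency is the nearest-neighbour form / second moment in the PRODUCT sup metric of `Cell d × ℤ`
(`nnFormZ`, `CoerciveZ`, `Moment₂Z` — uniform over rows, there being infinitely many). -/

/-- **SPECIAL piece, bounded form `GammaKernelBdd K`**: every BOUNDED Γ-mode is a uniform translation (= `GammaKernel K` for finite `ι`,
`gammaKernelBdd_of_gammaKernel`; for `ι = ℤ` the 1D, SUBCRITICAL Liouville theorem of the layer chain). -/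
def GammaKernelBdd (K : Cell d → ι → ι → (V →L[ℝ] V)) : Prop :=
  ∀ v : ι → V, IsGammaMode K v → (∃ C : ℝ, ∀ α, ‖v α‖ ≤ C) → ∀ α β, v α = v β

/-- the bounded special fibre is WEAKER than the plain one: `GammaKernel K → GammaKernelBdd K` (drop the boundedness hypothesis). -/
theorem gammaKernelBdd_of_gammaKernel {K : Cell d → ι → ι → (V →L[ℝ] V)} (h : GammaKernel K) : GammaKernelBdd K :=
  fun v hv _ => h v hv

/-- **K2♭ · modal target ∧ BOUNDED special piece ⇒ TARGET** (the Γ-modes `a j` produced by K1 are increments of a bounded-gradient field,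
hence bounded: `‖a j α‖ ≤ C·(dist 0 e_j + 1)`). -/
theorem linLiouville_of_modal_bdd {K : Cell d → ι → ι → (V →L[ℝ] V)} (hM : LinLiouvilleModal K) (hΓ : GammaKernelBdd K) :
    LinLiouville K := by
  intro u hu hg
  obtain ⟨a, c, hmode, hrep⟩ := hM u hu hg
  obtain ⟨C, hC⟩ := hg
  classical
  have hbd : ∀ j : Fin d, ∃ C' : ℝ, ∀ α, ‖a j α‖ ≤ C' := by
    intro j
    refine ⟨C * (dist (0 : Cell d) (Pi.single j 1) + 1), fun α => ?_⟩
    have h := hC 0 (Pi.single j 1) α α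
    rw [hrep (Pi.single j 1) α, hrep 0 α, sum_single_smul] at h
    simpa using h
  rcases isEmpty_or_nonempty ι with hι | ⟨⟨α₀⟩⟩
  · exact ⟨fun _ => 0, c, fun γ α => (IsEmpty.false α).elim⟩
  · refine ⟨fun j => a j α₀, c, fun γ α => ?_⟩
    rw [hrep γ α]
    congr 1
    exact Finset.sum_congr rfl fun j _ => by rw [hΓ (a j) (hmode j) (hbd j) α α₀]

/-- **K♭ = K2♭ ∘ K1 · generic ∧ bounded-special ⇒ TARGET** — the exhaustion used for layered structures (§D). -/
theorem linLiouville_of_boundedFlat_of_gammaKernelBdd {K : Cell d → ι → ι → (V →L[ℝ] V)}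
    (hG : BoundedFlat K) (hΓ : GammaKernelBdd K) : LinLiouville K :=
  linLiouville_of_modal_bdd (linLiouvilleModal_of_boundedFlat hG) hΓ

/-- the LAYER-LOCAL nearest-neighbour strain form for index set `ℤ`: pairs of sites at sup-distance `≤ 1` in `Cell d × ℤ` (adjacent cells AND
adjacent layers; a `finsum`, finite for finitely supported `φ`). -/
def nnFormZ (φ : Cell d → ℤ → V) : ℝ :=
  ∑ᶠ x : (Cell d × ℤ) × (Cell d × ℤ), if dist x.1 x.2 ≤ 1 then ‖φ x.2.1 x.2.2 - φ x.1.1 x.1.2‖ ^ 2 else 0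

/-- **CERTIFICATE `CoerciveZ K κ`** (harmonic stability of a LAYERED structure in lattice form): `κ · nnFormZ φ ≤ ½ Σ_{p,q} ⟪φ q − φ p, K(q − p)(φ q − φ p)⟫`
for every finitely supported `φ` (second variation entered as a `HasSum` value — no junk). -/
def CoerciveZ (K : Cell d → ℤ → ℤ → (V →L[ℝ] V)) (κ : ℝ) : Prop :=
  ∀ φ : Cell d → ℤ → V, HasFiniteSupport φ → ∀ E : ℝ,
    HasSum (fun x : (Cell d × ℤ) × (Cell d × ℤ) =>
      ⟪φ x.2.1 x.2.2 - φ x.1.1 x.1.2, K (x.2.1 - x.1.1) x.1.2 x.2.2 (φ x.2.1 x.2.2 - φ x.1.1 x.1.2)⟫) E →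
    κ * nnFormZ φ ≤ E / 2

/-- UNIFORM second moment of the force constants in the product metric of `Cell d × ℤ`, row-wise:
`sup_i Σ_{(δ,j)} ‖K δ i j‖ (dist (0,i) (δ,j) + 1)² < ∞`. -/
def Moment₂Z (K : Cell d → ℤ → ℤ → (V →L[ℝ] V)) : Prop :=
  ∃ M : ℝ, ∀ i : ℤ, Summable (fun x : Cell d × ℤ => ‖K x.1 i x.2‖ * (dist ((0 : Cell d), i) x + 1) ^ 2) ∧
    ∑' x : Cell d × ℤ, ‖K x.1 i x.2‖ * (dist ((0 : Cell d), i) x + 1) ^ 2 ≤ M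

/-- **ANALYTIC REDUCTION `DecayFromCoercivityZ K`** for layer-indexed kernels (ATTACKABLE·M/L; the SAME discrete Caccioppoli steps as
`DecayFromCoercivity` in the cell directions — cell increments of harmonic fields are harmonic because `K` depends on the cell DIFFERENCE only,
however it depends on the layer pair `(i, j)` — give `BoundedFlat` in ⌈(d+1)/2⌉ steps; then ONE 1D Caccioppoli step on the layer chain
`K̄ i j = Σ_δ K δ i j` (coercive on the 1D nn form by testing `CoerciveZ` against `χ_L(γ) v i`, `L → ∞`) gives `GammaKernelBdd`; periodicity in
the layer direction is never used). -/
def DecayFromCoercivityZ (K : Cell d → ℤ → ℤ → (V →L[ℝ] V)) : Prop :=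
  Symm K → SelfAdj K → Moment₂Z K → (∃ κ : ℝ, 0 < κ ∧ CoerciveZ K κ) → BoundedFlat K ∧ GammaKernelBdd K

/-- the layered analytic reduction composed with the bounded exhaustion: certificate ⇒ TARGET (modulo `DecayFromCoercivityZ`). -/
theorem linLiouville_of_decayZ {K : Cell d → ℤ → ℤ → (V →L[ℝ] V)} (hD : DecayFromCoercivityZ K)
    (hS : Symm K) (hA : SelfAdj K) (hM : Moment₂Z K) (hC : ∃ κ : ℝ, 0 < κ ∧ CoerciveZ K κ) : LinLiouville K :=
  linLiouville_of_boundedFlat_of_gammaKernelBdd (hD hS hA hM hC).1 (hD hS hA hM hC).2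

end Abstract

/-! ## §B  The Lennard-Jones (multi)lattice: periodic Barlow stackings (any period), fcc (|ι| = 1), hcp (|ι| = 2) -/

section LJ

variable {n : ℕ}

/-- site `(γ, α)` of the periodic multilattice with Bravais basis `A` and motif `m`:  `Σ_j γ_j A_j + m α`
(a `p`-periodic inner-relaxed Barlow stacking `LayeredHom L w`, `w (k + p) = w k + b`, is the case
`A = (L t₁, L t₂, b)`, `m = w|_{Fin p}`; fcc: `p = 1`, `b` oblique; hcp: `p = 2`). -/
def site (A : Fin 3 → E3) (m : Fin n → E3) (γ : Cell 3) (α : Fin n) : E3 :=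
  (∑ j, (γ j : ℝ) • A j) + m α

/-- the point set of the multilattice. -/
def siteSet (A : Fin 3 → E3) (m : Fin n → E3) : Set E3 :=
  Set.range fun x : Cell 3 × Fin n => site A m x.1 x.2

/-- a `δ`-separated crystal: injective site map, `δ`-separated point set. -/
def IsCrystal (δ : ℝ) (A : Fin 3 → E3) (m : Fin n → E3) : Prop :=
  Function.Injective (fun x : Cell 3 × Fin n => site A m x.1 x.2) ∧ IsSep δ (siteSet A m)

/-- **the Lennard-Jones bond force-constant operator** `K(w) = h(|w|²)·1 + 2h′(|w|²)·(w ⊗ w)`, `h(x) = −x⁻⁷ + x⁻⁴` — the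
differential at the bond `w` of the pair force `v ↦ (V′(|v|)/|v|)·v`, `V = r⁻¹²/12 − r⁻⁶/6`.  VERBATIM the tree's
`ExcessDecayLiouville.forceConst` (Theorems/ExcessDecayLiouvilleHcpLiouvilleAnchorNewton.lean:57 — DEDUP HOOK: that module's import
chain `…ExcessDecayLiouvilleLinearisation` was unbuilt on the farm at typing time (lean check rc 75 stale:unbuilt ×2), so the
two-line definition is mirrored here instead of imported; `forceConst_apply`, `inner_forceConst_eq_Hess₀` (quadratic form = the
route's `Hess`), `norm_forceConst_le` (`‖K(w)‖ ≤ 38|w|⁻⁸`, `|w| ≥ 9/10`), `hasFDerivAt_ljForce` are the tree facts about it). -/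
def forceConst (w : E3) : E3 →L[ℝ] E3 :=
  (-((‖w‖ ^ 2)⁻¹) ^ 7 + ((‖w‖ ^ 2)⁻¹) ^ 4) • ContinuousLinearMap.id ℝ E3 +
    (2 * (7 * ((‖w‖ ^ 2)⁻¹) ^ 8 - 4 * ((‖w‖ ^ 2)⁻¹) ^ 5)) • InnerProductSpace.rankOne ℝ w w

/-- `K(w)d = h(|w|²)·d + (2⟪w,d⟫h′(|w|²))·w` (tree: `forceConst_apply`, same proof). -/
theorem forceConst_apply (w d : E3) :
    forceConst w d = (-((‖w‖ ^ 2)⁻¹) ^ 7 + ((‖w‖ ^ 2)⁻¹) ^ 4) • d +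
      (2 * ⟪w, d⟫ * (7 * ((‖w‖ ^ 2)⁻¹) ^ 8 - 4 * ((‖w‖ ^ 2)⁻¹) ^ 5)) • w := by
  simp [forceConst]
  module

/-- **the harmonic Lennard-Jones kernel** at the crystal `(A, m)`: the bond force-constant operator at every bond
`site(δ, β) − site(0, α)`; infinite range, `‖K‖ ≤ 38|bond|⁻⁸`. -/
def ljKernel (A : Fin 3 → E3) (m : Fin n → E3) : Cell 3 → Fin n → Fin n → (E3 →L[ℝ] E3) :=
  fun δ α β => if δ = 0 ∧ β = α then 0 else forceConst (site A m δ β - site A m 0 α)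

/-- **per-geometry stability certificate** (INSTRUMENTABLE: TAG 138′ (i′) full-BZ phonon positivity at `(A, m)`). -/
def CrystalStable (A : Fin 3 → E3) (m : Fin n → E3) : Prop :=
  ∃ κ : ℝ, 0 < κ ∧ Coercive (ljKernel A m) κ

/-- **T · `LatticeLinLiouville`** — THE TARGET OF THIS NODE (theorem-shaped, census-free): every separated, harmonically STABLE
Lennard-Jones multilattice satisfies the linear statics Liouville theorem. -/
def LatticeLinLiouville : Prop :=
  ∀ (n : ℕ) (A : Fin 3 → E3) (m : Fin n → E3) (δ : ℝ), 0 < δ → IsCrystal δ A m → CrystalStable A m →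
    LinLiouville (ljKernel A m)

/-- the two Caccioppoli steps for LJ multilattices (ATTACKABLE·M/L). -/
def LJDecay : Prop :=
  ∀ (n : ℕ) (A : Fin 3 → E3) (m : Fin n → E3) (δ : ℝ), 0 < δ → IsCrystal δ A m → DecayFromCoercivity (ljKernel A m)

/-- second moments of the LJ force constants on a separated crystal (ATTACKABLE·S/M: `‖K(e)‖ ≤ C(δ)|e|⁻⁸`, `|e|⁻⁸·|e|² = |e|⁻⁶`
summable over a `δ`-separated set in `ℝ³`). -/
def LJMoments : Prop :=
  ∀ (n : ℕ) (A : Fin 3 → E3) (m : Fin n → E3) (δ : ℝ), 0 < δ → IsCrystal δ A m → Moment₂ (ljKernel A m)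

/-- **C · `CleanCrystalStability`** — THE CENSUS CERTIFICATE (INSTRUMENTABLE, TAG 138′ (i′); stable-sub-window caveat, row 390 (3)):
every separated periodic LJ multilattice whose point set is (1/16, 9/10, 1)-two-shell CLEAN and single-site NASH (= the homogeneously
strained, inner-relaxed clean crystals, of any stacking period) is harmonically stable. -/
def CleanCrystalStability : Prop :=
  ∀ (n : ℕ) (A : Fin 3 → E3) (m : Fin n → E3) (δ : ℝ), 0 < δ → IsCrystal δ A m →
    IsClean (μS (siteSet A m)) → IsNash (μS (siteSet A m)) → CrystalStable A m

/-- **L · `LatticeLiouvilleCert`** — what lens-3's nonlinear transfer consumes: clean ∧ Nash periodic LJ crystals satisfy the linear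
statics Liouville theorem.  (v8) SCALE TOLERANCE to `[9/10, 103/100]`: YES — at `IsClean`: it quantifies over clean ∧ Nash multilattices AT THEIR
OWN scale; widening the clean spacing window only enlarges the certified family (Nash pins Barlow spacings near `a⋆ ≈ 0.9712` anyway). -/
def LatticeLiouvilleCert : Prop :=
  ∀ (n : ℕ) (A : Fin 3 → E3) (m : Fin n → E3) (δ : ℝ), 0 < δ → IsCrystal δ A m →
    IsClean (μS (siteSet A m)) → IsNash (μS (siteSet A m)) → LinLiouville (ljKernel A m)

/-! ### symmetry of the LJ kernel (proved) -/

/-- the bond Hessian is EVEN in the bond vector: `forceConst (−w) = forceConst w` (action–reaction). -/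
theorem forceConst_neg (w : E3) : forceConst (-w) = forceConst w := by
  ext d
  simp only [forceConst_apply, norm_neg, inner_neg_left, smul_neg, mul_neg, neg_mul, neg_smul, neg_neg]

/-- the bond Hessian `forceConst w` is a SYMMETRIC operator: `⟪forceConst w x, y⟫ = ⟪x, forceConst w y⟫`. -/
theorem inner_forceConst_comm (w x y : E3) : ⟪forceConst w x, y⟫ = ⟪x, forceConst w y⟫ := by
  rw [forceConst_apply, forceConst_apply, inner_add_left, inner_add_right, real_inner_smul_left, real_inner_smul_left,
    real_inner_smul_right, real_inner_smul_right]
  simp only [real_inner_comm x w]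
  ring

/-- reversing a bond of the multilattice: the bond from sublattice `β` in cell `0` to `α` in cell `−δ` is minus the bond from `α` in cell `0` to `β` in cell `δ`. -/
theorem site_neg_sub (A : Fin 3 → E3) (m : Fin n → E3) (δ : Cell 3) (α β : Fin n) :
    site A m (-δ) α - site A m 0 β = -(site A m δ β - site A m 0 α) := by
  simp only [site, Pi.neg_apply, Int.cast_neg, neg_smul, Finset.sum_neg_distrib, Pi.zero_apply, Int.cast_zero, zero_smul,
    Finset.sum_const_zero, zero_add]
  abel

/-- **action–reaction symmetry of the LJ kernel** (central pair potential: `K(−e) = K(e) = K(e)ᵀ`). -/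
theorem ljKernel_symm (A : Fin 3 → E3) (m : Fin n → E3) : Symm (ljKernel A m) := by
  intro δ α β x y
  by_cases h : δ = 0 ∧ β = α
  · obtain ⟨rfl, rfl⟩ := h
    simp [ljKernel]
  · have h' : ¬(-δ = 0 ∧ α = β) := fun hh => h ⟨by simpa using hh.1, hh.2.symm⟩
    simp only [ljKernel, h, h', if_false]
    rw [site_neg_sub, forceConst_neg, inner_forceConst_comm]

/-- **blockwise self-adjointness of the LJ kernel.** -/
theorem ljKernel_selfAdj (A : Fin 3 → E3) (m : Fin n → E3) : SelfAdj (ljKernel A m) := by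
  intro δ α β x y
  by_cases h : δ = 0 ∧ β = α
  · obtain ⟨rfl, rfl⟩ := h
    simp [ljKernel]
  · simp only [ljKernel, h, if_false]
    rw [inner_forceConst_comm]

/-! ### the proved compositions on the LJ side -/

/-- **T ⟸ LJDecay ∧ LJMoments** (both symmetries discharged in-node). -/
theorem latticeLinLiouville_of (hD : LJDecay) (hM : LJMoments) : LatticeLinLiouville :=
  fun n A m δ hδ hX hS =>
    linLiouville_of_decay (hD n A m δ hδ hX) (ljKernel_symm A m) (ljKernel_selfAdj A m) (hM n A m δ hδ hX) hS

/-- **L ⟸ T ∧ C.** -/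
theorem latticeLiouvilleCert_of (hT : LatticeLinLiouville) (hC : CleanCrystalStability) : LatticeLiouvilleCert :=
  fun n A m δ hδ hX hcl hna => hT n A m δ hδ hX (hC n A m δ hδ hX hcl hna)

/-- the generic and special pieces in LJ-family form (for the record and the probes). -/
def LatticeBoundedFlat : Prop :=
  ∀ (n : ℕ) (A : Fin 3 → E3) (m : Fin n → E3) (δ : ℝ), 0 < δ → IsCrystal δ A m → CrystalStable A m → BoundedFlat (ljKernel A m)

/-- **Γ in family form**: every separated STABLE LJ multilattice has the special-fibre property `GammaKernel (ljKernel A m)`. [this file] -/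
def LatticeGammaKernel : Prop :=
  ∀ (n : ℕ) (A : Fin 3 → E3) (m : Fin n → E3) (δ : ℝ), 0 < δ → IsCrystal δ A m → CrystalStable A m → GammaKernel (ljKernel A m)

/-- **T ⟸ G ∧ Γ in family form** (the lens cut, PROVED). -/
theorem latticeLinLiouville_of_pieces (hG : LatticeBoundedFlat) (hΓ : LatticeGammaKernel) : LatticeLinLiouville :=
  fun n A m δ hδ hX hS => linLiouville_of_boundedFlat_of_gammaKernel (hG n A m δ hδ hX hS) (hΓ n A m δ hδ hX hS)

/-- **G ⟸ T in family form** (the generic piece is WEAKER, PROVED). -/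
theorem latticeBoundedFlat_of (hT : LatticeLinLiouville) : LatticeBoundedFlat :=
  fun n A m δ hδ hX hS => boundedFlat_of_linLiouville (hT n A m δ hδ hX hS)

/-- **fcc rung**: for monatomic crystals (`n = 1`) the special piece is PROVED, so T|_{n=1} ⟸ G|_{n=1}. -/
theorem linLiouville_fcc_of_boundedFlat (A : Fin 3 → E3) (m : Fin 1 → E3) (hG : BoundedFlat (ljKernel A m)) :
    LinLiouville (ljKernel A m) :=
  linLiouville_of_boundedFlat_bravais hG

end LJ

end Summit.AtomisticToContinuum.Crystallization.Theorems.ChartedZeroExcessLayeredLatticeLiouville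

end
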